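import Literature.Analysis.FluidPDE.TorusNonlinearInstability
import Literature.Analysis.FunctionSpaces.TorusSpectralWeakDerivative
import Literature.Analysis.FunctionSpaces.TorusInverseLaplacianCalculus
import HarnessLib

/-!
# Friedlander–Pavlović–Shvydkoy 2006, Thm. 2.2 on `𝕋³`: `L²` form and the real-eigenpair entry,
# DERIVED from the fact of record `Torus.fps2006_nonlinear_instability_of_eigenvalue`

Analysis/FluidPDE Literature file, THEOREMS ONLY (no named fact, nothing asserted; D-0014).

History (D-0026 bookkeeping). The first version of this file (p406628) declared the named fact
`FriedlanderPavlovicShvydkoy2006_nonlinearInstability` (Thm. 2.2 on `𝕋³`, real-eigenpair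
hypothesis written inline, `L^p` exit for all `1 < p < ∞`). Eight minutes earlier the same
printed theorem had landed as `Torus.fps2006_nonlinear_instability_of_eigenvalue`
(`TorusNonlinearInstability.lean`, p406626: complex eigenvalue `μ`, `Re μ > 0`, in the tree's
linearisation vocabulary `Torus.IsLinNSEigenvalue`, kinetic-energy exit), which has a kernel
consumer. One printed theorem, one named fact: the duplicate is RETIRED here and replaced by
theorems over the fact of record —

* `Torus.eLpNorm_two_eq_ofReal_sqrt_two_mul_kineticEnergy` (+ two inequalities): the bridge
  `‖v‖_{L²(𝕋^d)} = √(2 E(v))` between `Torus.kineticEnergy` and `eLpNorm · 2` for smooth fields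
  (private plumbing: the complexification identities for `divergenceC`, `stretch`, `gradientC`,
  `Torus.convect`, `Torus.laplacian` of `LinearizedNSTorus`);
* `Torus.isLinNSEigenvalue_of_realEigenpair`: a REAL eigenpair of the linearisation written with a
  pressure, `−(U·∇)φ − (φ·∇)U + νΔφ − ∇π = λφ`, `φ ≠ 0` smooth divergence free, `λ ≠ 0`, `U` smooth
  divergence free, IS an eigenvalue `(λ : ℂ)` in the sense of `Torus.IsLinNSEigenvalue` (complexify
  `φ`, `π`; the mean-zero clause of `Torus.LinNSResolventRel` follows by integrating the equation
  over `𝕋^d`: every term but `λ∫φ` integrates to zero for divergence-free `U`, `φ`);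
* `Torus.fps2006_nonlinear_instability_L2` / `…_of_realEigenpair`: Thm. 2.2 on `𝕋³` with the
  `L²`-norm (`eLpNorm · 2 volume`) measuring datum and exit, from a complex eigenvalue resp. from a
  real eigenpair — the `p = 2` case of the retired fact, now a theorem modulo the fact of record;
* `Torus.not_L2_stable_of_realEigenpair`: the negated-stability shadow (Def. 2.1) the cell
  `ns-blowup` consumes.

Source: S. Friedlander, N. Pavlović, R. Shvydkoy, *Nonlinear instability for the Navier–Stokes
equations*, Comm. Math. Phys. 264 (2006) 335–347 = arXiv:math/0508173 (held copy
`paper:arxiv-math_0508173`): Def. 2.1 and Thm. 2.2 (p. 4), proof for finite domains §3 (pp. 6–7: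
"in the case of a finite domain all eigenfunctions of `A` are infinitely smooth"; datum `v₀ = εφ`).
The TODO of the fact of record (all `1 < p < ∞`, `q > max(p, n)`, bounded domains / `ℝⁿ`, mild
solutions) is unchanged by this file.

## References

* S. Friedlander, N. Pavlović, R. Shvydkoy, Comm. Math. Phys. 264 (2006) 335–347,
  arXiv:math/0508173: Def. 2.1, Thm. 2.2 (p. 4), §3 (pp. 6–7). [FriedlanderPavlovicShvydkoy2006]
* L. C. Evans, *Partial Differential Equations*, 2nd ed., AMS (2010), App. C.2 (integration by
  parts on a domain without boundary). [Evans2010]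
-/

noncomputable section

open MeasureTheory Set Function Filter Topology
open Literature.Analysis.FunctionSpaces
open scoped ENNReal NNReal InnerProductSpace

namespace Literature.Analysis.FluidPDE

namespace Torus

variable {d : Type*} [Fintype d] [DecidableEq d]

/-! ### Kinetic energy versus the `L²` norm on `𝕋^d` -/

omit [DecidableEq d] in
/-- `‖v‖_{L²(𝕋^d)} = √(2 E(v))` for a smooth field, `E(v) = ½∫‖v‖² = ½‖v‖²_{L²}`
(`Torus.kineticEnergy`; `volume` is the Haar probability measure; Doering–Foias 2002, §2: the
kinetic energy is half the squared `L²` norm). [cite: DoeringFoias2002, §2] -/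
theorem eLpNorm_two_eq_ofReal_sqrt_two_mul_kineticEnergy
    {v : UnitAddTorus d → EuclideanSpace ℝ d} (hv : Torus.IsSmooth v) :
    eLpNorm v 2 volume = ENNReal.ofReal (Real.sqrt (2 * Torus.kineticEnergy v)) := by
  rw [(hv.memLp 2).eLpNorm_eq_integral_rpow_norm two_ne_zero ENNReal.ofNat_ne_top]
  congr 1
  rw [Real.sqrt_eq_rpow, Torus.kineticEnergy, mul_inv_cancel_left₀ (two_ne_zero' ℝ)]
  simp only [ENNReal.toReal_ofNat, Real.rpow_two, one_div]

omit [DecidableEq d] in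
/-- `E(v) < δ²/2 ⟹ ‖v‖_{L²} < δ` for a smooth field (`E = ½‖·‖²_{L²}`, Doering–Foias 2002, §2).
[cite: DoeringFoias2002, §2] -/
theorem eLpNorm_two_lt_of_kineticEnergy_lt {v : UnitAddTorus d → EuclideanSpace ℝ d}
    (hv : Torus.IsSmooth v) {δ : ℝ} (hδ : 0 < δ) (h : Torus.kineticEnergy v < δ ^ 2 / 2) :
    eLpNorm v 2 volume < ENNReal.ofReal δ := by
  rw [eLpNorm_two_eq_ofReal_sqrt_two_mul_kineticEnergy hv, ENNReal.ofReal_lt_ofReal_iff hδ,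
    Real.sqrt_lt' hδ]
  linarith

omit [DecidableEq d] in
/-- `ρ ≤ E(v) ⟹ √(2ρ) ≤ ‖v‖_{L²}` for a smooth field (`E = ½‖·‖²_{L²}`, Doering–Foias 2002, §2).
[cite: DoeringFoias2002, §2] -/
theorem ofReal_sqrt_le_eLpNorm_two_of_le_kineticEnergy {v : UnitAddTorus d → EuclideanSpace ℝ d}
    (hv : Torus.IsSmooth v) {ρ : ℝ} (h : ρ ≤ Torus.kineticEnergy v) :
    ENNReal.ofReal (Real.sqrt (2 * ρ)) ≤ eLpNorm v 2 volume := by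
  rw [eLpNorm_two_eq_ofReal_sqrt_two_mul_kineticEnergy hv]
  exact ENNReal.ofReal_le_ofReal (Real.sqrt_le_sqrt (by linarith))

/-! ### Complexified real fields in the vocabulary of `LinearizedNSTorus`

The tree already has `Torus.IsSmooth.complexify_comp`, `Torus.partialDeriv_clm_comp`,
`Torus.partialDeriv_complexify_comp` (`TorusFourierCalculus`), `Torus.IsSmooth.ofReal_comp`,
`Torus.partialDeriv_ofReal_comp` (`TorusSpectralWeakDerivative`), `Torus.laplacian_clm_comp_apply`
(`TorusInverseLaplacianCalculus`) and `integrable_complexify_comp` (`TorusVectorParseval`); below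
only the identities for the `LinearizedNSTorus` operators (`divergenceC`, `stretch`, `gradientC`,
`Torus.convect`) are added. -/

omit [Fintype d] [DecidableEq d] in
/-- `Torus.realToComplex` is the coordinatewise complexification `EuclideanSpace.complexify`
(a real linear isometry). [folklore] -/
private theorem realToComplex_eq_complexify [Fintype d] (v : EuclideanSpace ℝ d) :
    realToComplex v = EuclideanSpace.complexify v := rfl

omit [DecidableEq d] in
/-- `D(ι ∘ φ)(x) v = ι (Dφ(x) v)` for the complexification `ι` and `C¹` `φ`. [folklore] -/
private theorem fderiv_complexify_comp {φ : UnitAddTorus d → EuclideanSpace ℝ d} (hφ : Torus.IsContDiff 1 φ)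
    (x : UnitAddTorus d) (v : EuclideanSpace ℝ d) :
    Torus.fderiv (EuclideanSpace.complexify ∘ φ) x v =
      EuclideanSpace.complexify (Torus.fderiv φ x v) := by
  have hd : DifferentiableAt ℝ (Torus.liftAt φ x) 0 :=
    ((hφ.liftAt x).differentiable one_ne_zero).differentiableAt
  have hcomp : Torus.liftAt (EuclideanSpace.complexify ∘ φ) x =
      ⇑(EuclideanSpace.complexify (ι := d)).toContinuousLinearMap ∘ Torus.liftAt φ x := rfl
  unfold Torus.fderiv
  rw [hcomp, ((EuclideanSpace.complexify (ι := d)).toContinuousLinearMap.hasFDerivAt.comp 0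
    hd.hasFDerivAt).fderiv]
  rfl

omit [DecidableEq d] in
/-- `(u·∇)(ι ∘ φ) = ι ∘ (u·∇)φ` for smooth `φ`. [folklore] -/
private theorem convect_complexify_comp (u : UnitAddTorus d → EuclideanSpace ℝ d)
    {φ : UnitAddTorus d → EuclideanSpace ℝ d} (hφ : Torus.IsSmooth φ) (x : UnitAddTorus d) :
    Torus.convect u (EuclideanSpace.complexify ∘ φ) x =
      EuclideanSpace.complexify (Torus.convect u φ x) :=
  fderiv_complexify_comp (hφ.isContDiff (by simp)) x (u x)

/-- `Δ(ι ∘ φ) = ι ∘ Δφ` for smooth `φ` (`Torus.laplacian_clm_comp_apply`). [folklore] -/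
private theorem laplacian_complexify_comp {φ : UnitAddTorus d → EuclideanSpace ℝ d}
    (hφ : Torus.IsSmooth φ) (x : UnitAddTorus d) :
    Torus.laplacian (EuclideanSpace.complexify ∘ φ) x =
      EuclideanSpace.complexify (Torus.laplacian φ x) :=
  Torus.laplacian_clm_comp_apply hφ (EuclideanSpace.complexify (ι := d)).toContinuousLinearMap x

/-- `div (ι ∘ φ) = (div φ : ℂ)` for smooth `φ`. [folklore] -/
private theorem divergenceC_complexify_comp {φ : UnitAddTorus d → EuclideanSpace ℝ d}
    (hφ : Torus.IsSmooth φ) (x : UnitAddTorus d) :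
    divergenceC (EuclideanSpace.complexify ∘ φ) x = ((Torus.divergence φ x : ℝ) : ℂ) := by
  simp only [divergenceC, Torus.divergence, Function.comp_apply, EuclideanSpace.complexify_apply,
    Complex.ofReal_sum]
  exact Finset.sum_congr rfl fun i _ => Torus.partialDeriv_ofReal_comp (hφ.apply i) i x

/-- The stretching term of a complexified real field is the complexified convective derivative:
`((ι ∘ φ)·∇)u = ι ∘ (φ·∇)u` for smooth `u`. [folklore] -/
private theorem stretch_complexify_comp {u : UnitAddTorus d → EuclideanSpace ℝ d} (hu : Torus.IsSmooth u)
    (φ : UnitAddTorus d → EuclideanSpace ℝ d) (x : UnitAddTorus d) :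
    stretch (EuclideanSpace.complexify ∘ φ) u x =
      EuclideanSpace.complexify (Torus.convect φ u x) := by
  rw [stretch, Torus.convect, Torus.fderiv_apply_eq_sum_partialDeriv (hu.isContDiff (by simp)),
    map_sum]
  refine Finset.sum_congr rfl fun j _ => ?_
  simp only [map_smul, realToComplex_eq_complexify, Function.comp_apply,
    EuclideanSpace.complexify_apply]
  ext i
  simp [Complex.real_smul]

/-- Coordinates of the torus gradient are the partial derivatives, `(∇θ(x))ᵢ = ∂ᵢθ(x)` for `C¹`
`θ` (a copy of `Torus.gradient_apply` of `TorusMollifierEstimates`, kept private to avoid that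
import). [folklore] -/
private theorem gradient_coord_eq_partialDeriv {θ : UnitAddTorus d → ℝ} (hθ : Torus.IsContDiff 1 θ)
    (x : UnitAddTorus d) (i : d) : (Torus.gradient θ x) i = Torus.partialDeriv i θ x := by
  have h := Torus.inner_gradient_left θ x (EuclideanSpace.single i (1 : ℝ))
  rw [EuclideanSpace.inner_single_right, one_mul, conj_trivial] at h
  rw [h, Torus.partialDeriv_eq_fderiv_apply hθ]

/-- `∇(π : ℂ) = ι (∇π)` for a smooth real scalar `π`. [folklore] -/
private theorem gradientC_ofReal_comp {π : UnitAddTorus d → ℝ} (hπ : Torus.IsSmooth π) (x : UnitAddTorus d) :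
    gradientC (fun y => (π y : ℂ)) x = EuclideanSpace.complexify (Torus.gradient π x) := by
  ext i
  rw [EuclideanSpace.complexify_apply, gradient_coord_eq_partialDeriv (hπ.isContDiff (by simp)),
    ← Torus.partialDeriv_ofReal_comp hπ]
  rfl

/-! ### Real eigenpairs of the linearisation -/

/-- **Mean zero of real eigenfunctions.** If `U`, `φ` are smooth and divergence free, `π` is
smooth and `−(U·∇)φ − (φ·∇)U + νΔφ − ∇π = λφ` on `𝕋^d` with `λ ≠ 0`, then `∫_{𝕋^d} φ = 0`:
integrating, `∫(U·∇)φ = ∫(φ·∇)U = 0` (transport identity for divergence-free fields),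
`∫Δφ = ∑ᵢ∫∂ᵢ∂ᵢφ = 0`, `∫∇π = 0` (Evans, App. C.2, empty boundary), so `λ∫φ = 0`.
[cite: Evans2010, App. C.2 Thm. 2] -/
theorem integral_eq_zero_of_realEigenpair {ν lam : ℝ}
    {U φ : UnitAddTorus d → EuclideanSpace ℝ d} {π : UnitAddTorus d → ℝ}
    (hU : Torus.IsSmooth U) (hUdiv : Torus.IsDivFree U) (hφ : Torus.IsSmooth φ)
    (hπ : Torus.IsSmooth π) (hφdiv : Torus.IsDivFree φ) (hlam : lam ≠ 0)
    (heig : ∀ x, -(Torus.convect U φ x) - Torus.convect φ U x + ν • Torus.laplacian φ x -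
      Torus.gradient π x = lam • φ x) :
    ∫ x, φ x = 0 := by
  have h1 : ∫ x, Torus.convect U φ x = 0 := Torus.integral_fderiv_apply_eq_zero_of_isDivFree hU hφ hUdiv
  have h2 : ∫ x, Torus.convect φ U x = 0 := Torus.integral_fderiv_apply_eq_zero_of_isDivFree hφ hU hφdiv
  have h3 : ∫ x, Torus.laplacian φ x = 0 := by
    have hl : Torus.laplacian φ = fun x => ∑ i, Torus.partialDeriv i (Torus.partialDeriv i φ) x :=
      funext (Torus.laplacian_eq_sum_partialDeriv_partialDeriv hφ)
    rw [hl, integral_finsetSum]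
    · exact Finset.sum_eq_zero fun i _ => Torus.integral_partialDeriv_eq_zero_holds (hφ.partialDeriv i) i
    · exact fun i _ => ((hφ.partialDeriv i).partialDeriv i).integrable
  have h4 : ∫ x, Torus.gradient π x = 0 := by
    have hint : Integrable (Torus.gradient π) volume := hπ.gradient.integrable
    ext i
    have hc := (EuclideanSpace.proj (𝕜 := ℝ) i).integral_comp_comm hint
    simp only [EuclideanSpace.coe_proj] at hc
    rw [← hc]
    simp_rw [gradient_coord_eq_partialDeriv (hπ.isContDiff (by simp))]
    rw [Torus.integral_partialDeriv_eq_zero_holds hπ i]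
    rfl
  have hi1 : Integrable (Torus.convect U φ) volume := (hU.convect hφ).integrable
  have hi2 : Integrable (Torus.convect φ U) volume := (hφ.convect hU).integrable
  have hi3 : Integrable (fun x => ν • Torus.laplacian φ x) volume := hφ.laplacian.integrable.smul ν
  have hi4 : Integrable (Torus.gradient π) volume := hπ.gradient.integrable
  have hiN : Integrable (fun x => -(Torus.convect U φ x)) volume := hi1.neg
  have hiA : Integrable (fun x => -(Torus.convect U φ x) - Torus.convect φ U x) volume :=
    hiN.sub hi2
  have hiB : Integrable
      (fun x => -(Torus.convect U φ x) - Torus.convect φ U x + ν • Torus.laplacian φ x) volume :=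
    hiA.add hi3
  have key : ∫ x, lam • φ x =
      ∫ x, (-(Torus.convect U φ x) - Torus.convect φ U x + ν • Torus.laplacian φ x -
        Torus.gradient π x) :=
    integral_congr_ae (Eventually.of_forall fun x => (heig x).symm)
  rw [integral_smul, integral_sub hiB hi4, integral_add hiA hi3, integral_sub hiN hi2,
    integral_neg, integral_smul, h1, h2, h3, h4] at key
  simp only [neg_zero, sub_zero, smul_zero, add_zero, smul_eq_zero] at key
  exact key.resolve_left hlam

/-- **A real eigenpair is an eigenvalue of the linearisation** (`Torus.IsLinNSEigenvalue`). Let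
`U` be smooth and divergence free on `𝕋^d`, and let `φ ≠ 0` smooth divergence free, `π` smooth,
`λ ≠ 0` satisfy `−(U·∇)φ − (φ·∇)U + νΔφ − ∇π = λφ`. Then `(λ : ℂ)` is an eigenvalue of
`L(ν, U) w = νΔw − (U·∇)w − (w·∇)U − ∇q` in the sense of `LinearizedNSTorus`: the witness is the
complexified pair `(ι ∘ φ, (π : ℂ))`, which is smooth, divergence free and — by
`integral_eq_zero_of_realEigenpair` — mean zero. (On `𝕋ⁿ` the spectrum of the linearised
operator is discrete and consists of eigenvalues with smooth eigenfunctions,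
Friedlander–Pavlović–Shvydkoy 2006, p. 6; this lemma feeds certified REAL eigenpairs into
`Torus.fps2006_nonlinear_instability_of_eigenvalue`.) The statement rendered: an eigenpair
`(μ, φ)`, `Aφ = μφ`, of `A v = ℙ[−(U₀·∇)v − (v·∇)U₀ + R⁻¹Δv]` (§2, p. 4; the Leray projector `ℙ`
written out with the pressure `π`) is an eigenpair of the linearised operator of the tree
(`Torus.linearizedNSOperator`, Constantin–Foias 1988, Ch. 7, complex coefficients).
[cite: FriedlanderPavlovicShvydkoy2006, §2 p. 4 (operator `A`) and §3 p. 6 (eigenpair `(μ, φ)`)] -/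
theorem isLinNSEigenvalue_of_realEigenpair {ν lam : ℝ}
    {U φ : UnitAddTorus d → EuclideanSpace ℝ d} {π : UnitAddTorus d → ℝ}
    (hU : Torus.IsSmooth U) (hUdiv : Torus.IsDivFree U) (hφ : Torus.IsSmooth φ)
    (hπ : Torus.IsSmooth π) (hφdiv : Torus.IsDivFree φ) (hφ0 : φ ≠ 0) (hlam : lam ≠ 0)
    (heig : ∀ x, -(Torus.convect U φ x) - Torus.convect φ U x + ν • Torus.laplacian φ x -
      Torus.gradient π x = lam • φ x) :
    IsLinNSEigenvalue ν U (lam : ℂ) := by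
  refine ⟨EuclideanSpace.complexify ∘ φ, ?_, hφ.complexify_comp, ?_, ?_,
    fun y => (π y : ℂ), hπ.ofReal_comp, fun x => ?_⟩
  · -- `ι ∘ φ ≠ 0`
    intro hw
    apply hφ0
    funext x
    have hx := congrFun hw x
    simp only [Function.comp_apply, Pi.zero_apply] at hx
    rw [Pi.zero_apply]
    exact EuclideanSpace.complexify_injective (by rw [hx, map_zero])
  · -- Torus.divergence free
    intro x
    rw [divergenceC_complexify_comp hφ, hφdiv x, Complex.ofReal_zero]
  · -- mean zero
    have hc := (EuclideanSpace.complexify (ι := d)).toContinuousLinearMap.integral_comp_comm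
      hφ.integrable
    simp only [LinearIsometry.coe_toContinuousLinearMap] at hc
    show ∫ x, (EuclideanSpace.complexify ∘ φ) x = 0
    simp only [Function.comp_apply]
    rw [hc, integral_eq_zero_of_realEigenpair hU hUdiv hφ hπ hφdiv hlam heig, map_zero]
  · -- the eigen-equation, coordinatewise in `ℂ`
    rw [Pi.zero_apply, linearizedNSOperator_apply, convect_complexify_comp U hφ,
      stretch_complexify_comp hU, laplacian_complexify_comp hφ, gradientC_ofReal_comp hπ]
    have hx := congrArg (fun v : EuclideanSpace ℝ d => EuclideanSpace.complexify v) (heig x)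
    simp only [map_sub, map_add, map_neg, map_smul] at hx
    ext i
    have hxi := congrArg (fun v : EuclideanSpace ℂ d => v i) hx
    simp only [PiLp.sub_apply, PiLp.add_apply, PiLp.neg_apply, PiLp.smul_apply,
      EuclideanSpace.complexify_apply, Complex.real_smul] at hxi
    simp only [PiLp.sub_apply, PiLp.add_apply, PiLp.smul_apply, PiLp.zero_apply,
      Function.comp_apply, EuclideanSpace.complexify_apply, Complex.real_smul, smul_eq_mul]
    linear_combination hxi

/-! ### Thm. 2.2 on `𝕋³` in `L²` form, from the fact of record -/

/-- **Friedlander–Pavlović–Shvydkoy 2006, Thm. 2.2 on `𝕋³`, `L²` form** (from the fact of record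
`Torus.fps2006_nonlinear_instability_of_eigenvalue`). If `U` is a smooth steady state of
`NS_ν(f)` on `𝕋³` (`ν > 0`) whose linearisation has an eigenvalue `μ` with `Re μ > 0`, then there
is `ρ > 0` such that for every `δ > 0` some smooth divergence-free `v₀` with `‖v₀‖_{L²} < δ` has
the property that EVERY global classical solution `(u, p)` of `NS_ν(f)` on `[0, ∞) × 𝕋³` with
`u(0) = U + v₀` satisfies `‖u(t) − U‖_{L²} ≥ ρ` at some `t ≥ 0` (the kinetic-energy radii of the
fact, `E = ½‖·‖²_{L²}`, transported by `‖v‖_{L²} = √(2E(v))`).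
[cite: FriedlanderPavlovicShvydkoy2006, Thm. 2.2 + Def. 2.1 (p. 4), §3 pp. 6–7] -/
theorem fps2006_nonlinear_instability_L2 (h : fps2006_nonlinear_instability_of_eigenvalue)
    {ν : ℝ} (hν : 0 < ν) {f U : UnitAddTorus (Fin 3) → EuclideanSpace ℝ (Fin 3)}
    {P : UnitAddTorus (Fin 3) → ℝ} (hS : IsSteadyNSState ν f U P)
    {μ : ℂ} (hμ : 0 < μ.re) (heig : IsLinNSEigenvalue ν U μ) :
    ∃ ρ : ℝ, 0 < ρ ∧ ∀ δ : ℝ, 0 < δ →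
      ∃ v₀ : UnitAddTorus (Fin 3) → EuclideanSpace ℝ (Fin 3),
        Torus.IsSmooth v₀ ∧ Torus.IsDivFree v₀ ∧ eLpNorm v₀ 2 volume < ENNReal.ofReal δ ∧
        ∀ (u : ℝ → UnitAddTorus (Fin 3) → EuclideanSpace ℝ (Fin 3))
          (pr : ℝ → UnitAddTorus (Fin 3) → ℝ),
          Torus.IsClassicalNSSolutionOn (Ici 0) ν (fun _ => f) u pr → u 0 = U + v₀ →
            ∃ t : ℝ, 0 ≤ t ∧ ENNReal.ofReal ρ ≤ eLpNorm (u t - U) 2 volume := by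
  have hS' : Torus.IsClassicalNSSolutionOn univ ν (fun _ => f) (fun _ => U) (fun _ => P) := hS
  have hUs : Torus.IsSmooth U := hS'.smooth_velocity.isSmooth_slice (Set.mem_univ (0 : ℝ))
  obtain ⟨ρ, hρ, H⟩ := h ν hν f U P hS ⟨μ, hμ, heig⟩
  refine ⟨Real.sqrt (2 * ρ), Real.sqrt_pos.2 (by positivity), fun δ hδ => ?_⟩
  obtain ⟨v₀, hv₀, hdiv₀, hE₀, hall⟩ := H (δ ^ 2 / 2) (by positivity)
  refine ⟨v₀, hv₀, hdiv₀, eLpNorm_two_lt_of_kineticEnergy_lt hv₀ hδ hE₀, fun u pr hu h0 => ?_⟩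
  obtain ⟨t, ht, hρt⟩ := hall u pr hu h0
  have hut : Torus.IsSmooth (u t) := hu.smooth_velocity.isSmooth_slice (Set.mem_Ici.2 ht)
  exact ⟨t, ht, ofReal_sqrt_le_eLpNorm_two_of_le_kineticEnergy (hut.sub hUs) hρt⟩

/-- **Thm. 2.2 on `𝕋³`, `L²` form, real-eigenpair entry** — the statement of the retired named
fact `FriedlanderPavlovicShvydkoy2006_nonlinearInstability` at `p = 2`, now a THEOREM modulo the
fact of record: a smooth steady forced flow `(U, P)` on `𝕋³` (`Torus.IsClassicalNSSolutionOn univ`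
on constant data) whose linearisation has a real eigenvalue `λ > 0` with a smooth divergence-free
eigenfunction `φ ≠ 0` and pressure `π` (`−(U·∇)φ − (φ·∇)U + νΔφ − ∇π = λφ`) is Lyapunov
unstable in `L²` in the sense of `fps2006_nonlinear_instability_L2`.
[cite: FriedlanderPavlovicShvydkoy2006, Thm. 2.2 + Def. 2.1 (p. 4), §3 pp. 6–7] -/
theorem fps2006_nonlinear_instability_L2_of_realEigenpair
    (h : fps2006_nonlinear_instability_of_eigenvalue) {ν : ℝ} (hν : 0 < ν)
    {U : UnitAddTorus (Fin 3) → EuclideanSpace ℝ (Fin 3)} {P : UnitAddTorus (Fin 3) → ℝ}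
    {f : UnitAddTorus (Fin 3) → EuclideanSpace ℝ (Fin 3)}
    (hsteady : Torus.IsClassicalNSSolutionOn univ ν (fun _ => f) (fun _ => U) (fun _ => P))
    {lam : ℝ} (hlam : 0 < lam)
    {φ : UnitAddTorus (Fin 3) → EuclideanSpace ℝ (Fin 3)} {π : UnitAddTorus (Fin 3) → ℝ}
    (hφ : Torus.IsSmooth φ) (hπ : Torus.IsSmooth π) (hφdiv : Torus.IsDivFree φ) (hφ0 : φ ≠ 0)
    (heig : ∀ x, -(Torus.convect U φ x) - Torus.convect φ U x + ν • Torus.laplacian φ x -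
      Torus.gradient π x = lam • φ x) :
    ∃ ρ : ℝ, 0 < ρ ∧ ∀ δ : ℝ, 0 < δ →
      ∃ v₀ : UnitAddTorus (Fin 3) → EuclideanSpace ℝ (Fin 3),
        Torus.IsSmooth v₀ ∧ Torus.IsDivFree v₀ ∧ eLpNorm v₀ 2 volume < ENNReal.ofReal δ ∧
        ∀ (u : ℝ → UnitAddTorus (Fin 3) → EuclideanSpace ℝ (Fin 3))
          (pr : ℝ → UnitAddTorus (Fin 3) → ℝ),
          Torus.IsClassicalNSSolutionOn (Ici 0) ν (fun _ => f) u pr → u 0 = U + v₀ →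
            ∃ t : ℝ, 0 ≤ t ∧ ENNReal.ofReal ρ ≤ eLpNorm (u t - U) 2 volume := by
  have hU : Torus.IsSmooth U := hsteady.smooth_velocity.isSmooth_slice (Set.mem_univ (0 : ℝ))
  have hUdiv : Torus.IsDivFree U := hsteady.divFree 0 (Set.mem_univ (0 : ℝ))
  exact fps2006_nonlinear_instability_L2 h hν hsteady (μ := (lam : ℂ)) (by simpa using hlam)
    (isLinNSEigenvalue_of_realEigenpair hU hUdiv hφ hπ hφdiv hφ0 hlam.ne' heig)

/-- Negated-stability shadow (Def. 2.1, `Z = L²`, classical solutions) in the form the cell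
`ns-blowup` consumes: under the fact of record, a steady forced flow on `𝕋³` with a real unstable
eigenpair admits NO stability modulus in `L²` — it is not the case that for every `ρ > 0` some
`δ > 0` makes every smooth divergence-free `v₀` with `‖v₀‖_{L²} < δ` evolve into a global classical
solution remaining in the open `ρ`-ball for all `t ≥ 0`.
[cite: FriedlanderPavlovicShvydkoy2006, Thm. 2.2 + Def. 2.1 (p. 4)] -/
theorem not_L2_stable_of_realEigenpair
    (h : fps2006_nonlinear_instability_of_eigenvalue) {ν : ℝ} (hν : 0 < ν)
    {U : UnitAddTorus (Fin 3) → EuclideanSpace ℝ (Fin 3)} {P : UnitAddTorus (Fin 3) → ℝ}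
    {f : UnitAddTorus (Fin 3) → EuclideanSpace ℝ (Fin 3)}
    (hsteady : Torus.IsClassicalNSSolutionOn univ ν (fun _ => f) (fun _ => U) (fun _ => P))
    {lam : ℝ} (hlam : 0 < lam)
    {φ : UnitAddTorus (Fin 3) → EuclideanSpace ℝ (Fin 3)} {π : UnitAddTorus (Fin 3) → ℝ}
    (hφ : Torus.IsSmooth φ) (hπ : Torus.IsSmooth π) (hφdiv : Torus.IsDivFree φ) (hφ0 : φ ≠ 0)
    (heig : ∀ x, -(Torus.convect U φ x) - Torus.convect φ U x + ν • Torus.laplacian φ x -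
      Torus.gradient π x = lam • φ x) :
    ¬ ∀ ρ : ℝ, 0 < ρ → ∃ δ : ℝ, 0 < δ ∧
      ∀ v₀ : UnitAddTorus (Fin 3) → EuclideanSpace ℝ (Fin 3),
        Torus.IsSmooth v₀ → Torus.IsDivFree v₀ → eLpNorm v₀ 2 volume < ENNReal.ofReal δ →
        ∃ (u : ℝ → UnitAddTorus (Fin 3) → EuclideanSpace ℝ (Fin 3))
          (pr : ℝ → UnitAddTorus (Fin 3) → ℝ),
          Torus.IsClassicalNSSolutionOn (Ici 0) ν (fun _ => f) u pr ∧ u 0 = U + v₀ ∧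
            ∀ t : ℝ, 0 ≤ t → eLpNorm (u t - U) 2 volume < ENNReal.ofReal ρ := by
  intro hstable
  obtain ⟨ρ, hρ, hρall⟩ :=
    fps2006_nonlinear_instability_L2_of_realEigenpair h hν hsteady hlam hφ hπ hφdiv hφ0 heig
  obtain ⟨δ, hδ, hδall⟩ := hstable ρ hρ
  obtain ⟨v₀, hv₀, hdiv₀, hsmall, hexit⟩ := hρall δ hδ
  obtain ⟨u, pr, hu, h0, hstay⟩ := hδall v₀ hv₀ hdiv₀ hsmall
  obtain ⟨t, ht, hbig⟩ := hexit u pr hu h0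
  exact absurd (hstay t ht) (not_lt.2 hbig)

end Torus

end Literature.Analysis.FluidPDE
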